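import Summits.BirchSwinnertonDyer.BirchSwinnertonDyer.Theorems.ManinLocalTwoThreeGaussStableThirtyTwo
import HarnessLib

/-!
# Level 32: the Gaussian squeeze — (S2)₃₂ `Λ(φ₃₂) ⊆ Λ(−16, 0)` ⟹ `|c| = 1` on `X₀(32)` (cell bsd-f2-manin, -an g49 §94.8)

Planner file `HOME/an/g49/Sketch-an-g49c.lean` §3 (ba17dc9aca9fc752) landed definition-free.  The Gaussian lattice
lemma (`exists_squareGenerator`, `lattice_eq_mulLeft_of_I_stable`) and the squeeze: if the period lattice of
`φ₃₂ = η(4τ)²η(8τ)²` lies in the lattice of the Weierstrass pair with invariants `g₂ = −16`, `g₃ = 0` (the Néron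
lattice of `32a1 : y² = x³ + 4x`, `c₄ = −192`, `c₆ = 0`), then — using (S1)₃₂ `GaussStableThirtyTwo.gaussStableThirtyTwo`
— `Λ_W = cν·Λ₁` with `ν ∈ ℤ[i]`, `c₄ (cν)⁴ = −192`, and `c₄ ≡ a₁⁴ ∈ {0, 1} (mod 8)` kills `c = 2`:
`|c(D)| = 1` for every globally minimal `W/ℚ` and every lattice-optimal `X₀(32)`-datum `D`
(`abs_maninConstant_eq_one_thirtyTwo_of_periodLattice_le_square`), hence `2 ∤ c(D)` (the shape of the crux
`ManinOddAtFour` at `N = 32`).  No modularity binder, no CDT.  BSD is not proved by this.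
-/

set_option autoImplicit false
set_option linter.dupNamespace false

noncomputable section

open scoped MatrixGroups ModularForm Topology Real
open Filter CongruenceSubgroup WeierstrassCurve Function Complex
open UpperHalfPlane hiding I
open Literature.NumberTheory.EllipticCurves Literature.NumberTheory.EllipticCurves.ModularForms
open Summit.BirchSwinnertonDyer.BirchSwinnertonDyer.Theorems.ManinLocalTwoThree

namespace Summit.BirchSwinnertonDyer.BirchSwinnertonDyer.Theorems.ManinLocalTwoThree.GaussianSqueezeThirtyTwo

/-! ## §3 The Gaussian lattice lemma and the squeeze (S1)₃₂ ∧ (S2)₃₂ ⟹ (B)₃₂ -/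

/-- Rounding in `ℤ[i]`: every `y` is within `N(·) < 1` of a Gaussian integer. [folklore] -/
theorem exists_gaussian_near (y : ℂ) : ∃ a b : ℤ, Complex.normSq (y - (a + b * I)) < 1 := by
  refine ⟨round y.re, round y.im, ?_⟩
  have hre : (y - ((round y.re : ℤ) + (round y.im : ℤ) * I)).re = y.re - round y.re := by simp
  have him : (y - ((round y.re : ℤ) + (round y.im : ℤ) * I)).im = y.im - round y.im := by simp
  rw [Complex.normSq_apply, hre, him]
  have hs := abs_sub_round y.re
  have ht := abs_sub_round y.im
  set σ := y.re - round y.re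
  set τ := y.im - round y.im
  have hσ2 : σ * σ ≤ 1 / 4 := by nlinarith [abs_nonneg σ, sq_abs σ]
  have hτ2 : τ * τ ≤ 1 / 4 := by nlinarith [abs_nonneg τ, sq_abs τ]
  linarith

/-- **Square lattice lemma.** A rank-two lattice `Λ ⊂ ℂ` stable under multiplication by `i` is `ℤ[i] · ℓ`
for any shortest nonzero vector `ℓ` (covering radius of the square lattice `< 1`). [folklore] -/
theorem exists_squareGenerator (L : PeriodPair) (hI : ∀ z ∈ L.lattice, I * z ∈ L.lattice) :
    ∃ ℓ : ℂ, ℓ ≠ 0 ∧ ∀ x, x ∈ L.lattice ↔ ∃ a b : ℤ, x = (a + b * I) * ℓ := by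
  obtain ⟨ℓ, hℓ, hℓ0, hmin⟩ := HexagonalSqueezeTwentySeven.exists_shortest L
  refine ⟨ℓ, hℓ0, fun x ↦ ⟨fun hx ↦ ?_, ?_⟩⟩
  · obtain ⟨a, b, hab⟩ := exists_gaussian_near (x / ℓ)
    refine ⟨a, b, ?_⟩
    set δ := x / ℓ - (a + b * I) with hδ
    have hz : x - (a + b * I) * ℓ = δ * ℓ := by
      rw [hδ]; field_simp
    have hmem : x - (a + b * I) * ℓ ∈ L.lattice := by
      have h1 : (a : ℂ) * ℓ ∈ L.lattice := by
        simpa [zsmul_eq_mul] using L.lattice.smul_mem a hℓ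
      have h2 : (b : ℂ) * (I * ℓ) ∈ L.lattice := by
        simpa [zsmul_eq_mul] using L.lattice.smul_mem b (hI ℓ hℓ)
      have : (a + b * I) * ℓ = a * ℓ + b * (I * ℓ) := by ring
      rw [this]
      exact L.lattice.sub_mem hx (L.lattice.add_mem h1 h2)
    by_contra hne
    have hne' : x - (a + b * I) * ℓ ≠ 0 := sub_ne_zero.mpr hne
    have hle := hmin _ hmem hne'
    rw [hz, norm_mul] at hle
    have hδ1 : ‖δ‖ < 1 := by
      have : ‖δ‖ ^ 2 < 1 := by rw [Complex.sq_norm]; exact hab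
      nlinarith [norm_nonneg δ]
    have hℓpos : 0 < ‖ℓ‖ := norm_pos_iff.mpr hℓ0
    nlinarith
  · rintro ⟨a, b, rfl⟩
    have h1 : (a : ℂ) * ℓ ∈ L.lattice := by
      simpa [zsmul_eq_mul] using L.lattice.smul_mem a hℓ
    have h2 : (b : ℂ) * (I * ℓ) ∈ L.lattice := by
      simpa [zsmul_eq_mul] using L.lattice.smul_mem b (hI ℓ hℓ)
    have : (a + b * I) * ℓ = a * ℓ + b * (I * ℓ) := by ring
    rw [this]
    exact L.lattice.add_mem h1 h2

/-- **Homothety of nested square lattices.** If `M ⊆ P` are both `i`-stable then `M = ν · P` with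
`ν = a + bi ∈ ℤ[i] ∖ 0`. [folklore] -/
theorem lattice_eq_mulLeft_of_I_stable {M P : PeriodPair} (hM : ∀ z ∈ M.lattice, I * z ∈ M.lattice)
    (hP : ∀ z ∈ P.lattice, I * z ∈ P.lattice) (hle : M.lattice ≤ P.lattice) :
    ∃ a b : ℤ, ∃ hν : ((a : ℂ) + b * I) ≠ 0,
      M.lattice = (P.mulLeft ((a : ℂ) + b * I) hν).lattice := by
  obtain ⟨m, hm0, hmgen⟩ := exists_squareGenerator M hM
  obtain ⟨p, hp0, hpgen⟩ := exists_squareGenerator P hP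
  have hmP : m ∈ P.lattice := hle ((hmgen m).mpr ⟨1, 0, by simp⟩)
  obtain ⟨a, b, hab⟩ := (hpgen m).mp hmP
  have hν : ((a : ℂ) + b * I) ≠ 0 := by
    intro h; rw [h, zero_mul] at hab; exact hm0 hab
  refine ⟨a, b, hν, ?_⟩
  ext x
  rw [PeriodPair.mem_mulLeft_lattice, hmgen, hpgen]
  constructor
  · rintro ⟨a', b', rfl⟩
    refine ⟨a', b', ?_⟩
    rw [hab]; field_simp
  · rintro ⟨a', b', h⟩
    refine ⟨a', b', ?_⟩
    have : x = ((a : ℂ) + b * I) * (((a' : ℂ) + b' * I) * p) := by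
      rw [← h]; field_simp
    rw [this, hab]; ring

/-- **The arithmetic endgame at 32.** `|m|·(c²n)² = 192`, `n ≥ 1`, `m ≡ 0 or 1 (mod 8)` force `|c| = 1`
(`c = 2` would need `|m| = 12` or `|m| = 3`, neither `≡ 0, 1 (mod 8)`). [folklore] -/
theorem abs_eq_one_of_arith32 (m c n : ℤ) (hn : 1 ≤ n) (h : |m| * (c ^ 2 * n) ^ 2 = 192)
    (hmod : m % 8 = 0 ∨ m % 8 = 1) : |c| = 1 := by
  obtain ⟨μ, hμ⟩ : ∃ μ : ℤ, μ = |m| := ⟨_, rfl⟩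
  obtain ⟨k, hk⟩ : ∃ k : ℤ, k = c ^ 2 * n := ⟨_, rfl⟩
  rw [← hμ, ← hk] at h
  have hμ0 : 0 ≤ μ := hμ ▸ abs_nonneg _
  have hk0 : 0 ≤ k := by rw [hk]; positivity
  have hk1 : 1 ≤ k := by
    by_contra hcon; rw [show k = 0 by omega] at h; simp at h
  have hμ1 : 1 ≤ μ := by
    by_contra hcon; rw [show μ = 0 by omega] at h; simp at h
  have hk14 : k ≤ 14 := by
    by_contra hcon
    have h15 : 15 ≤ k := by omega
    have h225 : (15 : ℤ) ^ 2 ≤ k ^ 2 := pow_le_pow_left₀ (by norm_num) h15 2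
    have : k ^ 2 ≤ μ * k ^ 2 := le_mul_of_one_le_left (by positivity) hμ1
    linarith
  have hc0 : c ≠ 0 := by
    rintro rfl
    simp at hk; omega
  rw [sq k] at h
  have hmμ : m = μ ∨ m = -μ := by
    rcases abs_choice m with h0 | h0
    · left; rw [hμ, h0]
    · right; rw [hμ, h0, neg_neg]
  -- `k² ∣ 192` with `1 ≤ k ≤ 14` leaves `k ∈ {1, 2, 4, 8}`
  have hk_cases : (k = 1 ∨ k = 2) ∨ (k = 4 ∧ μ = 12) ∨ (k = 8 ∧ μ = 3) := by
    interval_cases k <;> omega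
  rcases hk_cases with hk12 | ⟨hk4, hμ12⟩ | ⟨hk8, hμ3⟩
  · -- `c² n ≤ 2` with `n ≥ 1` ⟹ `c² ≤ 2`
    have hc2 : c ^ 2 ≤ 2 := by
      rcases hk12 with h1 | h2 <;> nlinarith [sq_nonneg c]
    have hcb : -1 ≤ c ∧ c ≤ 1 := by constructor <;> nlinarith [sq_nonneg c]
    obtain ⟨hlo, hhi⟩ := hcb
    interval_cases c <;> first | exact absurd rfl hc0 | simp
  · exfalso; rcases hmμ with h' | h' <;> omega
  · exfalso; rcases hmμ with h' | h' <;> omega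

/-- `c₄ ≡ a₁⁴ ≡ 0 or 1 (mod 8)` for an integral Weierstrass model (`c₄ = b₂² − 24b₄`, `b₂ = a₁² + 4a₂`). [folklore] -/
theorem c₄_emod_eight (W : WeierstrassCurve ℤ) : W.c₄ % 8 = 0 ∨ W.c₄ % 8 = 1 := by
  have hc4 : W.c₄ = (W.a₁ ^ 2 + 4 * W.a₂) ^ 2 - 24 * W.b₄ := by
    simp only [WeierstrassCurve.c₄, WeierstrassCurve.b₂]
  obtain ⟨t, ht | ht⟩ := Int.even_or_odd' W.a₁
  · have h : W.c₄ = 16 * (t ^ 2 + W.a₂) ^ 2 - 24 * W.b₄ := by rw [hc4, ht]; ring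
    generalize (t ^ 2 + W.a₂) ^ 2 = s at h
    omega
  · have h : W.c₄ = 16 * (t ^ 2 + t + W.a₂) ^ 2 + 8 * (t ^ 2 + t + W.a₂) + 1 - 24 * W.b₄ := by
      rw [hc4, ht]; ring
    generalize t ^ 2 + t + W.a₂ = s at h
    omega

/-- **Ligozat-32 in the kernel, modulo (S2)₃₂ (with (S1)₃₂ discharged by §2).**  If the period lattice of
`φ₃₂` lies in a period pair with invariants `g₂ = −16`, `g₃ = 0`, then `|c(D)| = 1` for every globally minimal
`W/ℚ` and every `X₀(32)`-datum `D` of `W` with the lattice clause.  No modularity binder, no CDT. [folklore] -/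
theorem abs_maninConstant_eq_one_thirtyTwo_of_periodLattice_le_square
    (h2 : ∃ L₁ : PeriodPair, L₁.g₂ = -16 ∧ L₁.g₃ = 0 ∧
      ∀ z ∈ periodLattice cuspFormEtaProductThirtyTwo, z ∈ L₁.lattice)
    (W : WeierstrassCurve ℚ) [W.IsGloballyMinimal] (D : ModularParametrizationData W 32)
    (hopt : ∀ z ∈ D.L.lattice, ∃ w ∈ periodLattice D.f, z = D.c * w) :
    |D.maninConstant| = 1 := by
  have h1 := GaussStableThirtyTwo.gaussStableThirtyTwo
  have hI4 : I ^ 4 = 1 := Complex.I_pow_four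
  have hf : D.f = cuspFormEtaProductThirtyTwo := GaussStableThirtyTwo.f_eq_etaProductThirtyTwo D
  obtain ⟨L₁, hg2, hg3, hle⟩ := h2
  show |D.c| = 1
  set c : ℤ := D.c with hc_def
  have hc0 : (c : ℂ) ≠ 0 := by
    intro hc
    have hω₁ : D.L.ω₁ ≠ 0 := by simpa using D.L.indep.ne_zero 0
    obtain ⟨w, -, hw⟩ := hopt D.L.ω₁ D.L.ω₁_mem_lattice
    rw [hc, zero_mul] at hw
    exact hω₁ hw
  have hMI : ∀ z ∈ D.L.lattice, I * z ∈ D.L.lattice := by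
    intro z hz
    obtain ⟨w, hw, rfl⟩ := hopt z hz
    have hw' : I * w ∈ periodLattice D.f := by
      rw [hf] at hw ⊢; exact h1 _ hw
    have := D.smul_periodLattice_le _ hw'
    convert this using 1; ring
  set P : PeriodPair := L₁.mulLeft (c : ℂ) hc0 with hP
  have hMP : D.L.lattice ≤ P.lattice := by
    intro z hz
    obtain ⟨w, hw, rfl⟩ := hopt z hz
    rw [hf] at hw
    exact PeriodPair.mul_mem_mulLeft_lattice.mpr (hle w hw)
  have hL₁I : ∀ z ∈ L₁.lattice, I * z ∈ L₁.lattice := by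
    have heq : (L₁.mulLeft I Complex.I_ne_zero).lattice = L₁.lattice := by
      apply PeriodPair.uniformization_unique_holds
      · rw [PeriodPair.g₂_mulLeft, hI4, inv_one, one_mul]
      · rw [PeriodPair.g₃_mulLeft, hg3, mul_zero]
    intro z hz
    rw [← heq]
    exact PeriodPair.mul_mem_mulLeft_lattice.mpr hz
  have hPI : ∀ z ∈ P.lattice, I * z ∈ P.lattice := by
    intro z hz
    rw [hP, PeriodPair.mem_mulLeft_lattice] at hz ⊢
    have := hL₁I _ hz
    convert this using 1; ring
  obtain ⟨a, b, hν, hMeq⟩ := lattice_eq_mulLeft_of_I_stable hMI hPI hMP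
  set ν : ℂ := (a : ℂ) + b * I with hν_def
  have hg3W : D.L.g₃ = 0 := by
    rw [PeriodPair.g₃_eq_of_lattice_eq hMeq, PeriodPair.g₃_mulLeft, hP, PeriodPair.g₃_mulLeft, hg3]
    ring
  have hg2W : D.L.g₂ = (ν ^ 4)⁻¹ * (((c : ℂ) ^ 4)⁻¹ * (-16)) := by
    rw [PeriodPair.g₂_eq_of_lattice_eq hMeq, PeriodPair.g₂_mulLeft, hP, PeriodPair.g₂_mulLeft, hg2]
  have hN2 : D.L.g₂ = (W.baseChange ℂ).c₄ / 12 := D.isNeronLattice.1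
  have hN3 : D.L.g₃ = (W.baseChange ℂ).c₆ / 216 := D.isNeronLattice.2
  set Wℤ : WeierstrassCurve ℤ := integralModelInt W with hWℤ
  have hW : Wℤ.map (Int.castRingHom ℚ) = W := map_integralModelInt W
  have hc4 : (W.baseChange ℂ).c₄ = (Wℤ.c₄ : ℂ) := by
    conv_lhs => rw [← hW]
    simp [WeierstrassCurve.baseChange, WeierstrassCurve.map_c₄]
  set m : ℤ := Wℤ.c₄ with hm
  have key : (m : ℂ) * (ν ^ 4 * (c : ℂ) ^ 4) = -192 := by
    have h : (ν ^ 4)⁻¹ * (((c : ℂ) ^ 4)⁻¹ * (-16)) = (m : ℂ) / 12 := by rw [← hg2W, hN2, hc4]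
    have hν4 : ν ^ 4 ≠ 0 := pow_ne_zero _ hν
    have hc4' : (c : ℂ) ^ 4 ≠ 0 := pow_ne_zero _ hc0
    have hA : (ν ^ 4)⁻¹ * ν ^ 4 = 1 := inv_mul_cancel₀ hν4
    have hB : ((c : ℂ) ^ 4)⁻¹ * (c : ℂ) ^ 4 = 1 := inv_mul_cancel₀ hc4'
    have e1 : (ν ^ 4)⁻¹ * (((c : ℂ) ^ 4)⁻¹ * (-16)) * (ν ^ 4 * (c : ℂ) ^ 4) * 12 = -192 := by
      calc (ν ^ 4)⁻¹ * (((c : ℂ) ^ 4)⁻¹ * (-16)) * (ν ^ 4 * (c : ℂ) ^ 4) * 12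
          = -192 * ((ν ^ 4)⁻¹ * ν ^ 4) * (((c : ℂ) ^ 4)⁻¹ * (c : ℂ) ^ 4) := by ring
        _ = -192 := by rw [hA, hB]; ring
    have e2 : (m : ℂ) / 12 * (ν ^ 4 * (c : ℂ) ^ 4) * 12 = (m : ℂ) * (ν ^ 4 * (c : ℂ) ^ 4) := by
      ring
    rw [← e2, ← h, e1]
  set n : ℤ := a ^ 2 + b ^ 2 with hn_def
  have hre : ν.re = a := by simp [hν_def]
  have him : ν.im = b := by simp [hν_def]
  have hn : Complex.normSq ν = (n : ℝ) := by
    rw [Complex.normSq_apply, hre, him, hn_def]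
    push_cast
    ring
  have hn1 : 1 ≤ n := by
    have : (0 : ℝ) < n := by rw [← hn]; exact Complex.normSq_pos.mpr hν
    exact_mod_cast this
  have hR : |(m : ℝ)| * (((c : ℝ) ^ 2 * (n : ℝ)) ^ 2) = 192 := by
    have hnorm := congrArg (‖·‖) key
    simp only [norm_mul, norm_pow, Complex.norm_intCast, norm_neg] at hnorm
    have h192 : ‖(192 : ℂ)‖ = 192 := by
      rw [show (192 : ℂ) = ((192 : ℕ) : ℂ) by norm_num, Complex.norm_natCast]; norm_num
    have hν2 : ‖ν‖ ^ 2 = (n : ℝ) := by rw [Complex.sq_norm, hn]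
    have hc2 : |(c : ℝ)| ^ 2 = (c : ℝ) ^ 2 := sq_abs _
    calc |(m : ℝ)| * (((c : ℝ) ^ 2 * (n : ℝ)) ^ 2)
        = |(m : ℝ)| * ((‖ν‖ ^ 2) ^ 2 * (|(c : ℝ)| ^ 2) ^ 2) := by rw [hν2, hc2]; ring
      _ = |(m : ℝ)| * (‖ν‖ ^ 4 * |(c : ℝ)| ^ 4) := by ring
      _ = 192 := by rw [hnorm, h192]
  have hZ : |m| * (c ^ 2 * n) ^ 2 = 192 := by exact_mod_cast hR
  exact abs_eq_one_of_arith32 m c n hn1 hZ (c₄_emod_eight Wℤ)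

/-- C2-shape corollary at `N = 32`: `2 ∤ c(D)`. [folklore] -/
theorem not_two_dvd_maninConstant_thirtyTwo_of_le_square
    (h2 : ∃ L₁ : PeriodPair, L₁.g₂ = -16 ∧ L₁.g₃ = 0 ∧
      ∀ z ∈ periodLattice cuspFormEtaProductThirtyTwo, z ∈ L₁.lattice)
    (W : WeierstrassCurve ℚ) [W.IsGloballyMinimal] (D : ModularParametrizationData W 32)
    (hopt : ∀ z ∈ D.L.lattice, ∃ w ∈ periodLattice D.f, z = D.c * w) :
    ¬ (2 : ℤ) ∣ D.maninConstant := by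
  have h := abs_maninConstant_eq_one_thirtyTwo_of_periodLattice_le_square h2 W D hopt
  intro h3
  have := Int.le_of_dvd (by rw [h]; norm_num) ((dvd_abs _ _).mpr h3)
  rw [h] at this
  norm_num at this

end Summit.BirchSwinnertonDyer.BirchSwinnertonDyer.Theorems.ManinLocalTwoThree.GaussianSqueezeThirtyTwo

end
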